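import Mathlib
import Literature.NumberTheory.Transcendental.KZProductIdeal
import Literature.NumberTheory.Transcendental.KZRelationsLE
import Literature.NumberTheory.Transcendental.SemialgebraicAlgebraicPoints

/-!
# `TateLifting` (stmt-KontsevichZagierPeriods-9129), line `Sketch` — stub `stub_pointMul`

MULTIPLICATION BY A POINT in the Kontsevich–Zagier calculus. A representation `r₀ = [pt, a]` of
dimension `0` with full domain `ℝ⁰ = {pt}` is the constant `a = r₀.integrand pt`, which is
real-ALGEBRAIC (the value of a `ℚ`-semialgebraic function at the vacuously algebraic point of `ℝ⁰`,
`IsSemialgebraicFunOn.isAlgebraic_apply`). For every representation `r = [σ, f]` of dimension `k`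
the Fubini product `[pt, a] * [σ, f] = [pt × σ, a ⊗ f]` (`KZ.of_mul_of`, `KZ.IntegralRep.prod`,
dimension `0 + k`) IS, as an integral representation, the coordinate relabelling along
`finCongr : Fin k ≃ Fin (0 + k)` of the scaled representation `[σ, a·f]`
(`KZ.IntegralRep.constMul`, dimension `k`): `PointMul.prod_eq_constMul_reindex` (domains: the point
factor of `pt × σ` is no condition; integrands: `KZ.IntegralRep.prod_integrand_eq`). Relabelling
coordinates is one change-of-variables move (`KZ.of_sub_of_reindex_mem_relations`), whence
`[pt, a] * [σ, f] − [σ, a·f] ∈ KZ.relations` (`tateLifting_pointMul`).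

References: M. Kontsevich, D. Zagier, *Periods* (2001), §1.1 ("rational" may be replaced by
"algebraic"), §1.2 rule (2), §4.1 ("the product of integrals is again an integral (Fubini)").
-/

noncomputable section

open MeasureTheory Set
open Literature.NumberTheory.Transcendental

namespace Summit.KontsevichZagierPeriods.InverseLandau

namespace PointMul

/-- **`[pt, a] · [σ, f]` is a relabelling of `[σ, a·f]`.** For a dimension-zero representation `r₀`
with full domain and `a = r₀.integrand pt` algebraic, the product representation `r₀.prod r`
(dimension `0 + k`) EQUALS the reindexing along `finCongr : Fin k ≃ Fin (0 + k)` of the scaled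
representation `r.constMul a _` (same domain `σ`, integrand `a·f`): both have domain
`{w | (w ∘ finCongr) ∈ σ}` and integrand `w ↦ a * f (w ∘ finCongr)` (the integrand of the product is
`a ⊗ f` by `KZ.IntegralRep.prod_integrand_eq`, and its point argument is `pt`). [folklore] -/
theorem prod_eq_constMul_reindex {k : ℕ} (r₀ : KZ.IntegralRep 0) (r : KZ.IntegralRep k)
    (hr₀ : r₀.domain = Set.univ) (ha : IsAlgebraic ℚ (r₀.integrand default)) :
    r₀.prod r =
      (r.constMul (r₀.integrand default) ha).reindex (finCongr (Nat.zero_add k).symm) := by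
  have hcoord : ∀ w : Fin (0 + k) → ℝ,
      (fun j => w (Fin.natAdd 0 j)) = fun i => w (finCongr (Nat.zero_add k).symm i) := by
    intro w
    funext j
    simp
  have hpt : ∀ w : Fin (0 + k) → ℝ, (fun i : Fin 0 => w (Fin.castAdd k i)) = default :=
    fun w => Subsingleton.elim _ _
  refine KZ.IntegralRep.ext' ?_ ?_
  · ext w
    simp only [KZ.IntegralRep.prod_domain, KZ.IntegralRep.mem_prodDomain, hr₀, mem_univ, true_and,
      KZ.IntegralRep.reindex_domain, KZ.IntegralRep.domain_constMul, mem_setOf_eq, hcoord]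
  · rw [KZ.IntegralRep.prod_integrand_eq, KZ.IntegralRep.reindex_integrand]
    funext w
    rw [KZ.IntegralRep.prodFun_apply, KZ.IntegralRep.integrand_constMul, hpt w, hcoord w]

end PointMul

/-- **Multiplication by a point** (stub `stub_pointMul` of the lead's skeleton, the body of
`PointMul`): for a representation `r₀ = [pt, a]` of dimension `0` with full domain and any
representation `r = [σ, f]` of dimension `k`, the scaled representation `r' = [σ, a·f]` (honest:
`a = r₀.integrand pt` is real-algebraic, `IsSemialgebraicFunOn.isAlgebraic_apply`, so `a·f` is again
`ℚ`-semialgebraic, `KZ.IntegralRep.constMul`) has domain `σ`, integrand `a·f`, and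
`[pt, a] * [σ, f] − [σ, a·f] ∈ KZ.relations`: the Fubini product `[pt × σ, a ⊗ f]`
(`KZ.of_mul_of`) is the relabelling of `[σ, a·f]` along `Fin k ≃ Fin (0 + k)`
(`PointMul.prod_eq_constMul_reindex`), one change-of-variables move away
(`KZ.of_sub_of_reindex_mem_relations`). [cite: KontsevichZagier2001, §4.1] -/
theorem tateLifting_pointMul :
    ∀ (k : ℕ) (r₀ : KZ.IntegralRep 0) (r : KZ.IntegralRep k), r₀.domain = Set.univ →
      ∃ r' : KZ.IntegralRep k, r'.domain = r.domain ∧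
        Set.EqOn r'.integrand (fun x => r₀.integrand default * r.integrand x) r.domain ∧
        KZ.of r₀ * KZ.of r - KZ.of r' ∈ KZ.relations := by
  intro k r₀ r hr₀
  have h0 : (default : Fin 0 → ℝ) ∈ r₀.domain := by
    rw [hr₀]
    exact mem_univ _
  have ha : IsAlgebraic ℚ (r₀.integrand default) :=
    r₀.isSemialgebraicFunOn_integrand.isAlgebraic_apply h0 fun i => i.elim0
  refine ⟨r.constMul (r₀.integrand default) ha, rfl, fun _ _ => rfl, ?_⟩
  rw [KZ.of_mul_of, PointMul.prod_eq_constMul_reindex r₀ r hr₀ ha, ← neg_sub]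
  exact KZ.relations.neg_mem (KZ.of_sub_of_reindex_mem_relations _ _)

end Summit.KontsevichZagierPeriods.InverseLandau

end
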